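import Summits.AtomisticToContinuum.FouriersLaw.Theorems.BondHeatUncertaintyExtensiveSnapshotIrreversibilityEnergyWindowPathHessianDerivative
import Summits.AtomisticToContinuum.FouriersLaw.Theorems.BondHeatUncertaintyExtensiveSnapshotIrreversibilityEnergyWindowInterpolation
import HarnessLib

/-!
# Bond heat uncertainty — energy window: positions and the Hessian are bounded UNIFORMLY IN TIME
  by the energy budget (rung (C2f) beneath the open leaf (COF))

Cell `decomp-a2c`, lens-1 «grading / quantitative ladder», generation 84, crux
`stmt-AtomisticToContinuum-9121` (`ExtensiveSnapshotIrreversibility`, K_fix half, leaf S3), part Q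
(imports part P `…EnergyWindowPathHessianDerivative`, part N `…EnergyWindowInterpolation` +
HarnessLib).  The pre-registered kill criterion of (COF) was «a SUP in time of the path energy»
(kinetic spikes at the bath sites are not in the budget `Θ_θ = ∫₀¹ e^{θ H}`).  The critic's remark
(row 1193) is made a theorem here: the costate system has POSITION-only coefficients, and positions
ARE budget-controlled uniformly in time, because they move at finite speed `q̇ = p` (part P) and a
continuous function is somewhere below its quadratic mean:

* `exists_sq_mul_le_intervalIntegral_sq` — `∃ r₀ ∈ [a,b], g(r₀)²(b-a) ≤ ∫ₐᵇ g²`;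
* `abs_le_sqrt_div_add_sqrt_mul` — if `G' = h` on `(a,b)` then for every `r ∈ [a,b]`
  `|G r| ≤ √(∫ₐᵇ G² / (b-a)) + √(∫ₐᵇ h²) √(b-a)` (minimum ≤ mean, plus the `C^{1/2}` oscillation
  bound (C2c) of part N);
* `sq_solMap_fst_le` — **`sup_{r ∈ [0,1]} q_k(r)² ≤ 4 (1 + 1/ω₂) Θ_θ / θ`** for every driven path,
  every noise, every `θ > 0` (`ω₂ q² ≤ 2H`, `p² ≤ 2H`, `∫₀¹ H ≤ Θ_θ/θ` of part O);
* `abs_hessPotential_le_of_sq_le` — `|∂²Φ_{ij}(q)| ≤ (ω₂ + 3 lam Q) + N² (1 + 12 β Q)` whenever all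
  `q_k² ≤ Q`;
* `abs_hessPotential_solMap_le` — **`sup_{r ∈ [0,1]} |∂²Φ_{ij}(q_r)| ≤ A_H + B_H Θ_θ/θ`** with
  `A_H = ω₂ + N²`, `B_H = (3 lam + 12 N² β) · 4 (1 + 1/ω₂)`: the coefficients of the costate
  system are bounded uniformly in time, polynomially in the budget.

References: parts N (C2c), O (C2d), P (C2e); tree `LangevinChainSDE` (`pinnedChain_deriv_U`,
`pinnedChain_U_le_hamiltonian`), `LangevinChainHormander` (`hessPotential`,
`pinnedChain_deriv_deriv_V`), `LangevinChainFlowBounds` (`pinnedChain_sum_sq_le_two_mul_hamiltonian`).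
-/

namespace Summit.AtomisticToContinuum.FouriersLaw.Theorems.ExtensiveSnapshotIrreversibility.EnergyWindow

open MeasureTheory Filter Topology Set Finset
open scoped Nat
open Literature.MathematicalPhysics.KineticTheory.HeatConduction Literature.Probability.Process

/-! ## 1. Minimum below the quadratic mean; sup ≤ mean + oscillation -/

/-- A continuous function on `[a,b]` is somewhere below its quadratic mean:
`∃ r₀ ∈ [a,b], g(r₀)² (b - a) ≤ ∫ₐᵇ g²`. [folklore] -/
theorem exists_sq_mul_le_intervalIntegral_sq {g : ℝ → ℝ} {a b : ℝ} (hab : a ≤ b)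
    (hg : ContinuousOn g (Icc a b)) :
    ∃ r₀ ∈ Icc a b, g r₀ ^ 2 * (b - a) ≤ ∫ u in a..b, g u ^ 2 := by
  obtain ⟨r₀, hr₀, hmin⟩ :=
    isCompact_Icc.exists_isMinOn (nonempty_Icc.2 hab) (f := fun r => g r ^ 2) (hg.pow 2)
  refine ⟨r₀, hr₀, ?_⟩
  have hmin' : ∀ u ∈ Icc a b, g r₀ ^ 2 ≤ g u ^ 2 := fun u hu => (isMinOn_iff.mp hmin) u hu
  calc g r₀ ^ 2 * (b - a) = ∫ u in a..b, g r₀ ^ 2 := by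
        rw [intervalIntegral.integral_const, smul_eq_mul]; ring
    _ ≤ ∫ u in a..b, g u ^ 2 :=
        intervalIntegral.integral_mono_on hab intervalIntegrable_const
          ((hg.pow 2).intervalIntegrable_of_Icc hab) hmin'

/-- **sup ≤ quadratic mean + `C^{1/2}` oscillation**: if `G' = h` on `(a,b)` (`a < b`), `G`, `h`
continuous on `[a,b]`, then for every `r ∈ [a,b]`,
`|G r| ≤ √(∫ₐᵇ G² / (b - a)) + √(∫ₐᵇ h²) · √(b - a)`. [folklore] -/
theorem abs_le_sqrt_div_add_sqrt_mul {G h : ℝ → ℝ} {a b : ℝ} (hab : a < b)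
    (hGc : ContinuousOn G (Icc a b)) (hGh : ∀ r ∈ Ioo a b, HasDerivAt G (h r) r)
    (hh : ContinuousOn h (Icc a b)) {r : ℝ} (hr : r ∈ Icc a b) :
    |G r| ≤ √((∫ u in a..b, G u ^ 2) / (b - a)) + √(∫ u in a..b, h u ^ 2) * √(b - a) := by
  obtain ⟨r₀, hr₀, h0⟩ := exists_sq_mul_le_intervalIntegral_sq hab.le hGc
  have hba : 0 < b - a := sub_pos.2 hab
  have h1 : |G r₀| ≤ √((∫ u in a..b, G u ^ 2) / (b - a)) :=
    Real.abs_le_sqrt (by rwa [le_div_iff₀ hba])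
  have h2 : |G r - G r₀| ≤ √(∫ u in a..b, h u ^ 2) * √(b - a) := by
    refine (abs_sub_le_sqrt_integral_sq_mul_sqrt hGc hGh hh hr hr₀).trans ?_
    gcongr
    rw [abs_le]; constructor <;> linarith [hr.1, hr.2, hr₀.1, hr₀.2]
  calc |G r| = |G r - G r₀ + G r₀| := by rw [sub_add_cancel]
    _ ≤ |G r - G r₀| + |G r₀| := abs_add_le _ _
    _ ≤ √(∫ u in a..b, h u ^ 2) * √(b - a) + √((∫ u in a..b, G u ^ 2) / (b - a)) :=
        add_le_add h2 h1
    _ = _ := by ring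

/-! ## 2. Hessian bound from a coordinate bound -/

/-- **`|∂²Φ_{ij}(q)| ≤ (ω₂ + 3 lam Q) + N² (1 + 12 β Q)`** whenever every coordinate satisfies
`q_k² ≤ Q`. [folklore] -/
theorem abs_hessPotential_le_of_sq_le {ω₂ lam β : ℝ} (γ : ℝ) (hω : 0 ≤ ω₂) (hl : 0 ≤ lam)
    (hβ : 0 ≤ β) (N : ℕ) {q : Fin N → ℝ} {Q : ℝ} (hQ0 : 0 ≤ Q) (hQ : ∀ k, q k ^ 2 ≤ Q)
    (i j : Fin N) :
    |(pinnedChain ω₂ lam β γ).hessPotential N i j q| ≤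
      (ω₂ + 3 * lam * Q) + (N : ℝ) * N * (1 + 12 * β * Q) := by
  -- second derivatives of the potentials
  have hU2 : ∀ a : ℝ, deriv (deriv (pinnedChain ω₂ lam β γ).U) a = ω₂ + 3 * lam * a ^ 2 := by
    intro a; rw [pinnedU_deriv_two_eq]
  have hV2 : ∀ r : ℝ, deriv (deriv (pinnedChain ω₂ lam β γ).V) r = 1 + 3 * β * r ^ 2 :=
    fun r => pinnedChain_deriv_deriv_V ω₂ lam β γ r
  have hind : ∀ (p q : Prop) [Decidable p] [Decidable q],
      |((if p then (1 : ℝ) else 0) - (if q then 1 else 0))| ≤ 1 := by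
    intro p q _ _; split_ifs <;> norm_num
  -- pinning entry
  have h1 : |deriv (deriv (pinnedChain ω₂ lam β γ).U) (q i) * (if i = j then 1 else 0)| ≤
      ω₂ + 3 * lam * Q := by
    have hnn : 0 ≤ deriv (deriv (pinnedChain ω₂ lam β γ).U) (q i) := by rw [hU2]; positivity
    have hι : |(if i = j then (1 : ℝ) else 0)| ≤ 1 := by split_ifs <;> norm_num
    calc |deriv (deriv (pinnedChain ω₂ lam β γ).U) (q i) * (if i = j then 1 else 0)|
        = deriv (deriv (pinnedChain ω₂ lam β γ).U) (q i) * |(if i = j then (1 : ℝ) else 0)| := by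
          rw [abs_mul, abs_of_nonneg hnn]
      _ ≤ deriv (deriv (pinnedChain ω₂ lam β γ).U) (q i) * 1 :=
          mul_le_mul_of_nonneg_left hι hnn
      _ ≤ ω₂ + 3 * lam * Q := by
          rw [mul_one, hU2]; nlinarith [mul_le_mul_of_nonneg_left (hQ i) hl]
  -- bond entries
  have h2 : ∀ k l : Fin N,
      |(if l.val = k.val + 1 then
          deriv (deriv (pinnedChain ω₂ lam β γ).V) (q l - q k) *
            ((if l = j then 1 else 0) - (if k = j then 1 else 0)) *
            ((if l = i then 1 else 0) - (if k = i then 1 else 0)) else (0 : ℝ))| ≤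
        1 + 12 * β * Q := by
    intro k l
    have hc : (0 : ℝ) ≤ 1 + 12 * β * Q := by positivity
    by_cases hlk : l.val = k.val + 1
    · rw [if_pos hlk]
      have hr : 3 * β * (q l - q k) ^ 2 ≤ 12 * β * Q := by
        have hb : (q l - q k) ^ 2 ≤ 2 * q l ^ 2 + 2 * q k ^ 2 := by
          nlinarith [sq_nonneg (q l + q k)]
        nlinarith [mul_le_mul_of_nonneg_left (hb.trans (by linarith [hQ l, hQ k] :
          2 * q l ^ 2 + 2 * q k ^ 2 ≤ 4 * Q)) hβ]
      have hnn : 0 ≤ deriv (deriv (pinnedChain ω₂ lam β γ).V) (q l - q k) := by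
        rw [hV2]; positivity
      have ha := hind (l = j) (k = j)
      have hb := hind (l = i) (k = i)
      calc |deriv (deriv (pinnedChain ω₂ lam β γ).V) (q l - q k) *
              ((if l = j then 1 else 0) - (if k = j then 1 else 0)) *
              ((if l = i then 1 else 0) - (if k = i then 1 else 0))|
          = deriv (deriv (pinnedChain ω₂ lam β γ).V) (q l - q k) *
              |((if l = j then (1 : ℝ) else 0) - (if k = j then 1 else 0))| *
              |((if l = i then (1 : ℝ) else 0) - (if k = i then 1 else 0))| := by
            rw [abs_mul, abs_mul, abs_of_nonneg hnn]
        _ ≤ deriv (deriv (pinnedChain ω₂ lam β γ).V) (q l - q k) * 1 * 1 := by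
            gcongr
        _ ≤ 1 + 12 * β * Q := by rw [mul_one, mul_one, hV2]; linarith
    · rw [if_neg hlk, abs_zero]; exact hc
  -- assemble
  unfold OscillatorChain.hessPotential
  refine (abs_add_le _ _).trans ?_
  have hsum : |∑ k : Fin N, ∑ l : Fin N,
      (if l.val = k.val + 1 then
          deriv (deriv (pinnedChain ω₂ lam β γ).V) (q l - q k) *
            ((if l = j then 1 else 0) - (if k = j then 1 else 0)) *
            ((if l = i then 1 else 0) - (if k = i then 1 else 0)) else (0 : ℝ))| ≤
      (N : ℝ) * ((N : ℝ) * (1 + 12 * β * Q)) := by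
    refine (Finset.abs_sum_le_sum_abs _ _).trans ?_
    calc ∑ k : Fin N, |∑ l : Fin N, (if l.val = k.val + 1 then
            deriv (deriv (pinnedChain ω₂ lam β γ).V) (q l - q k) *
              ((if l = j then 1 else 0) - (if k = j then 1 else 0)) *
              ((if l = i then 1 else 0) - (if k = i then 1 else 0)) else (0 : ℝ))|
        ≤ ∑ k : Fin N, ∑ l : Fin N, (1 + 12 * β * Q) :=
          Finset.sum_le_sum fun k _ =>
            (Finset.abs_sum_le_sum_abs _ _).trans (Finset.sum_le_sum fun l _ => h2 k l)
      _ = (N : ℝ) * ((N : ℝ) * (1 + 12 * β * Q)) := by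
          simp only [Finset.sum_const, Finset.card_univ, Fintype.card_fin, nsmul_eq_mul]
  refine (add_le_add h1 hsum).trans (le_of_eq ?_)
  ring

/-! ## 3. Along a driven path: positions and the Hessian, uniformly in time, in budget currency -/

section Path

variable {ω₂ lam β γ : ℝ} (hω : 0 < ω₂) (hl : 0 ≤ lam) (hβ : 0 ≤ β) (hγ : 0 ≤ γ) (N : ℕ)
  (T_L T_R : ℝ)

include hω hl hβ hγ in
/-- **Positions are budget-controlled uniformly in time**: for every driven path, every noise,
every `θ > 0`, every `r ∈ [0,1]` and every site `k`,
`q_k(Φ_r(z, B(wp)))² ≤ 4 (1 + 1/ω₂) · Θ_θ(z, wp) / θ`. [NEW · rung (C2f) beneath (COF)] -/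
theorem sq_solMap_fst_le {θ : ℝ} (hθ : 0 < θ) (z : PhaseSpace N) (wp : WienerPair) (k : Fin N)
    {r : ℝ} (hr : r ∈ Icc (0 : ℝ) 1) :
    ((pinnedChain ω₂ lam β γ).solMap N T_L T_R r z (pairPath wp)).1 k ^ 2 ≤
      4 * (1 + 1 / ω₂) * (1 / θ * energyBudget ω₂ lam β γ N T_L T_R θ z wp) := by
  set P := pinnedChain ω₂ lam β γ with hP
  set ζ : ℝ → PhaseSpace N := fun t => P.solMap N T_L T_R t z (pairPath wp) with hζ
  set Hp := pathEnergy ω₂ lam β γ N T_L T_R z wp with hHp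
  set I := ∫ u in (0 : ℝ)..1, Hp u with hI
  have hζc : Continuous ζ := pinnedChain_continuous_solMap hω hl hβ hγ N T_L T_R z (pairPath wp)
  have hGc : Continuous fun t => (ζ t).1 k := (continuous_apply k).comp (continuous_fst.comp hζc)
  have hhc : Continuous fun t => (ζ t).2 k := (continuous_apply k).comp (continuous_snd.comp hζc)
  have hHc : Continuous Hp := continuous_pathEnergy hω hl hβ hγ z wp
  have hderiv : ∀ t ∈ Ioo (0 : ℝ) 1, HasDerivAt (fun t => (ζ t).1 k) ((ζ t).2 k) t :=
    fun t ht => hasDerivAt_solMap_fst hω hl hβ hγ N T_L T_R z wp ht.1 k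
  have hmain := abs_le_sqrt_div_add_sqrt_mul one_pos hGc.continuousOn hderiv hhc.continuousOn hr
  simp only [sub_zero, div_one, Real.sqrt_one, mul_one] at hmain
  -- the two quadratic means are paid by `∫₀¹ H`
  have hq2 : ∫ u in (0 : ℝ)..1, (ζ u).1 k ^ 2 ≤ 2 / ω₂ * I := by
    have hpt : ∀ u, (ζ u).1 k ^ 2 ≤ 2 / ω₂ * Hp u := by
      intro u
      have h := pinnedChain_U_le_hamiltonian hω.le hl hβ γ N (ζ u) k
      have h' : ω₂ * (ζ u).1 k ^ 2 ≤ 2 * Hp u := by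
        have : Hp u = P.hamiltonian N (ζ u) := rfl
        rw [this]; nlinarith [mul_nonneg hl (pow_nonneg (sq_nonneg ((ζ u).1 k)) 2),
          pow_two ((ζ u).1 k ^ 2)]
      calc (ζ u).1 k ^ 2 = ω₂ * (ζ u).1 k ^ 2 / ω₂ := by field_simp
        _ ≤ 2 * Hp u / ω₂ := div_le_div_of_nonneg_right h' hω.le
        _ = 2 / ω₂ * Hp u := by ring
    calc ∫ u in (0 : ℝ)..1, (ζ u).1 k ^ 2 ≤ ∫ u in (0 : ℝ)..1, 2 / ω₂ * Hp u :=
          intervalIntegral.integral_mono_on zero_le_one ((hGc.pow 2).intervalIntegrable _ _)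
            ((continuous_const.mul hHc).intervalIntegrable _ _) fun u _ => hpt u
      _ = 2 / ω₂ * I := intervalIntegral.integral_const_mul _ _
  have hp2 : ∫ u in (0 : ℝ)..1, (ζ u).2 k ^ 2 ≤ 2 * I := by
    have hpt : ∀ u, (ζ u).2 k ^ 2 ≤ 2 * Hp u := fun u =>
      (Finset.single_le_sum (f := fun m => (ζ u).2 m ^ 2) (fun m _ => sq_nonneg _)
        (Finset.mem_univ k)).trans (pinnedChain_sum_sq_le_two_mul_hamiltonian hω hl hβ N (ζ u))
    calc ∫ u in (0 : ℝ)..1, (ζ u).2 k ^ 2 ≤ ∫ u in (0 : ℝ)..1, 2 * Hp u :=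
          intervalIntegral.integral_mono_on zero_le_one ((hhc.pow 2).intervalIntegrable _ _)
            ((continuous_const.mul hHc).intervalIntegrable _ _) fun u _ => hpt u
      _ = 2 * I := intervalIntegral.integral_const_mul _ _
  have hIΘ : I ≤ 1 / θ * energyBudget ω₂ lam β γ N T_L T_R θ z wp :=
    intervalIntegral_pathEnergy_le hω hl hβ hγ N hθ z wp le_rfl zero_le_one le_rfl
  have hI0 : 0 ≤ I := intervalIntegral.integral_nonneg zero_le_one
    fun u _ => pathEnergy_nonneg hω.le hl hβ z wp u
  -- combine: `q² ≤ (A + B)² ≤ 2A² + 2B²`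
  have hq0 : 0 ≤ ∫ u in (0 : ℝ)..1, (ζ u).1 k ^ 2 :=
    intervalIntegral.integral_nonneg zero_le_one fun u _ => sq_nonneg _
  have hp0 : 0 ≤ ∫ u in (0 : ℝ)..1, (ζ u).2 k ^ 2 :=
    intervalIntegral.integral_nonneg zero_le_one fun u _ => sq_nonneg _
  have hA := Real.sq_sqrt hq0
  have hB := Real.sq_sqrt hp0
  have hsq := pow_le_pow_left₀ (abs_nonneg _) hmain 2
  rw [sq_abs] at hsq
  have hω' : 0 ≤ 1 / ω₂ := by positivity
  nlinarith [hsq, sq_nonneg (√(∫ u in (0 : ℝ)..1, (ζ u).1 k ^ 2) - √(∫ u in (0 : ℝ)..1, (ζ u).2 k ^ 2)),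
    mul_le_mul_of_nonneg_left hIΘ hω', hq2, hp2, hIΘ,
    show 2 / ω₂ * I = 2 * (1 / ω₂ * I) by ring,
    mul_le_mul_of_nonneg_left hIΘ (by norm_num : (0 : ℝ) ≤ 4)]

include hω hl hβ hγ in
/-- **The costate coefficients are bounded uniformly in time, polynomially in the budget**:
for every driven path, every noise, every `θ > 0`, every `r ∈ [0,1]`,
`|∂²Φ_{ij}(q_r)| ≤ (ω₂ + N²) + (3 lam + 12 N² β) · 4 (1 + 1/ω₂) · Θ_θ / θ`.
[NEW · rung (C2f) beneath (COF)] -/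
theorem abs_hessPotential_solMap_le {θ : ℝ} (hθ : 0 < θ) (z : PhaseSpace N) (wp : WienerPair)
    (i j : Fin N) {r : ℝ} (hr : r ∈ Icc (0 : ℝ) 1) :
    |(pinnedChain ω₂ lam β γ).hessPotential N i j
        ((pinnedChain ω₂ lam β γ).solMap N T_L T_R r z (pairPath wp)).1| ≤
      (ω₂ + (N : ℝ) * N) + (3 * lam + (N : ℝ) * N * (12 * β)) *
        (4 * (1 + 1 / ω₂) * (1 / θ * energyBudget ω₂ lam β γ N T_L T_R θ z wp)) := by
  set Q := 4 * (1 + 1 / ω₂) * (1 / θ * energyBudget ω₂ lam β γ N T_L T_R θ z wp) with hQ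
  have hQ0 : 0 ≤ Q := by
    have h1 := one_le_energyBudget (T_L := T_L) (T_R := T_R) hω hl hβ hγ hθ.le z wp
    have hω' : 0 ≤ 1 / ω₂ := by positivity
    have hθ' : 0 ≤ 1 / θ := by positivity
    rw [hQ]; exact mul_nonneg (by positivity) (mul_nonneg hθ' (by linarith))
  have hq : ∀ k, ((pinnedChain ω₂ lam β γ).solMap N T_L T_R r z (pairPath wp)).1 k ^ 2 ≤ Q :=
    fun k => sq_solMap_fst_le hω hl hβ hγ N T_L T_R hθ z wp k hr
  refine (abs_hessPotential_le_of_sq_le γ hω.le hl hβ N hQ0 hq i j).trans (le_of_eq ?_)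
  ring

end Path

end Summit.AtomisticToContinuum.FouriersLaw.Theorems.ExtensiveSnapshotIrreversibility.EnergyWindow
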